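import Summits.KontsevichZagierPeriods.KontsevichZagierPeriods.Theorems.OctahedralSymmetryQuarterDiscFaceWeightTwoGreen

/-!
# Quarter-disc face of the octahedron: the two homotopies as Green's formulas with a rider

Support file for item `QuarterDiscFaceWeightTwo` (stmt-KontsevichZagierPeriods-9437, route
KontsevichZagierPeriods/OctahedralSymmetry): the two applications of the engine `green_rider`
(`Theorems/OctahedralSymmetryQuarterDiscFaceWeightTwoGreen.lean`) behind the identity
`Im I_{[0,i]}(e₀ e₋₁) = Im I_{[0,1]·arc}(e₀ e₋₁)`, i.e. `G + ((π/2) log 2 − G) − (π/2) log 2 = 0`.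
Throughout `ρ(s) = ((1 − s²) + 2is)/(1 + s²)` is the arc of the unit circle from `1` to `i`
(Zhao's `ρ(z) = (i − z)/(i + z)` restricted to `[0,1]`; `ρ'/ρ = 2i ds/(1 + s²)`).

* STEP ONE (outer homotopy, `step_one`). In the coordinates `z = r ρ(s)` of the closed quarter disc
  the closed `1`-form `dz/(1 + λz)` (`λ ∈ [0,1]` a rider: `∫₀¹ dλ/(1 + λz) = log(1 + z)/z`) has
  imaginary part `F dr + G ds`, `F = 2s/D`, `G = 2r((1 − s²) + λr(1 + s²))/((1 + s²)D)`,
  `D = (1 + λr)² + s²(1 − λr)²`, with `∂ₛF = ∂ᵣG = 2((1 + λr)² − s²(1 − λr)²)/D²`. Green on the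
  `(r, s)`-square gives `[S] − [T] ∈ KZ.relations` for the faces `s = 1` (`S = [[0,1]², 1/(1 + λ²r²)]`,
  the segment `[0, i]`; value Catalan's constant) and `r = 1` (`T`, the arc); the faces `s = 0`
  (the real segment) and `r = 0` have zero integrand.
* STEP TWO (inner homotopy, `step_two`). For `z = ρ(s)` on the arc the inner primitive
  `log(1 + z) = ∫₀^z dw/(1 + w)` is moved from the radial segment to `[0,1]` followed by the arc: in
  the coordinates `w = r'ρ(sμ)` of the sector (`(r', μ) ∈ [0,1]²`, rider `s`) the form
  `Im((ρ'/ρ)(s) · dw/(1 + w)) = (2/(1 + s²)) Re dw/(1 + w)` is `F dr' + G dμ`,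
  `F = 2((1 − σ²) + r'(1 + σ²))/((1 + s²)E)`, `G = −8sr'σ/((1 + s²)(1 + σ²)E)`, `σ = sμ`,
  `E = (1 + r')² + σ²(1 − r')²`, `∂_μF = ∂_{r'}G = −8sσ(1 − r'²)/((1 + s²)E²)`. Green gives
  `[T] − [R] − [M] ∈ KZ.relations`: faces `μ = 1` (`T` again), `μ = 0`
  (`R = [[0,1]², 2/((1 + s²)(1 + r'))]`, value `(π/2) log 2`), `r' = 1` (`M`, minus the arc–arc
  iterated integral before the cone substitution; value `G − (π/2) log 2`), `r' = 0` (zero).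

References: M. Kontsevich, D. Zagier, *Periods* (2001), §1.2 rules (1)–(3); J. Zhao, *Multiple
polylogarithm values at roots of unity*, C. R. Acad. Sci. Paris 346 (2008), §4 (octahedral
symmetry of `ℙ¹ ∖ {0, ∞, ±1, ±i}`); K. C. Au, arXiv:2201.01676, §5 (path homotopy + Möbius
pull-backs as a relation generator).
Design: theorems only; all functions are written out (no definitions).
-/

noncomputable section

open Set MeasureTheory MvPolynomial
open Literature.NumberTheory.Transcendental Literature.NumberTheory.Transcendental.KZ
open Literature.ModelTheory.ExponentialFields (IsSemialgebraic)

namespace Summit.KontsevichZagierPeriods.OctahedralSymmetry.QuarterDiscFace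


/-- Coordinates of a point of the closed cube are in `[0,1]`. [folklore] -/
theorem cube_coord {n : ℕ} {w : Fin n → ℝ} (hw : w ∈ cube n) (i : Fin n) : 0 ≤ w i ∧ w i ≤ 1 :=
  hw i

/-- **Step one of the quarter-disc face.** There are representations `S`, `T` on the closed unit
square with integrands `1/(1 + (z₀z₁)²)` and
`2((1 − z₀²) + z₁(1 + z₀²))/((1 + z₀²)((1 + z₁)² + z₀²(1 − z₁)²))` (the imaginary parts of
`∫ dz/(1+λz)` along the segment `[0,i]` and along the arc `ρ`, before the `λ`-integration) with
`[S] − [T] ∈ KZ.relations`: Green's formula with rider for the closed form `Im dz/(1+λz)` in the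
coordinates `z = rρ(s)` of the quarter disc. [cite: KontsevichZagier2001, §1.2 rule (3)] -/
theorem step_one : ∃ S T : IntegralRep 2,
    S.domain = cube 2 ∧ EqOn S.integrand (fun z => 1 / (1 + (z 0 * z 1) ^ 2)) (cube 2) ∧
    T.domain = cube 2 ∧ EqOn T.integrand (fun z => 2 * ((1 - z 0 ^ 2) + z 1 * (1 + z 0 ^ 2)) /
      ((1 + z 0 ^ 2) * ((1 + z 1) ^ 2 + z 0 ^ 2 * (1 - z 1) ^ 2))) (cube 2) ∧
    of S - of T ∈ relations := by
  -- the coefficient functions, coordinates `(r, λ, s)` for `F`, `H` and `(s, λ, r)` for `G`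
  set F : (Fin 3 → ℝ) → ℝ := fun w =>
    2 * w 2 / ((1 + w 0 * w 1) ^ 2 + w 2 ^ 2 * (1 - w 0 * w 1) ^ 2) with hF
  set H : (Fin 3 → ℝ) → ℝ := fun w =>
    2 * ((1 + w 0 * w 1) ^ 2 - w 2 ^ 2 * (1 - w 0 * w 1) ^ 2) /
      ((1 + w 0 * w 1) ^ 2 + w 2 ^ 2 * (1 - w 0 * w 1) ^ 2) ^ 2 with hH
  set G : (Fin 3 → ℝ) → ℝ := fun v =>
    2 * v 2 * ((1 - v 0 ^ 2) + v 1 * v 2 * (1 + v 0 ^ 2)) /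
      ((1 + v 0 ^ 2) * ((1 + v 2 * v 1) ^ 2 + v 0 ^ 2 * (1 - v 2 * v 1) ^ 2)) with hG
  -- denominators
  have hDpos : ∀ a b c : ℝ, 0 ≤ a → 0 ≤ b → 0 < (1 + a * b) ^ 2 + c ^ 2 * (1 - a * b) ^ 2 := by
    intro a b c ha hb
    have : 0 < 1 + a * b := by nlinarith [mul_nonneg ha hb]
    positivity
  have hD : ∀ w ∈ cube 3, 0 < (1 + w 0 * w 1) ^ 2 + w 2 ^ 2 * (1 - w 0 * w 1) ^ 2 := fun w hw =>
    hDpos _ _ _ (cube_coord hw 0).1 (cube_coord hw 1).1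
  have hD' : ∀ v ∈ cube 3,
      0 < (1 + v 0 ^ 2) * ((1 + v 2 * v 1) ^ 2 + v 0 ^ 2 * (1 - v 2 * v 1) ^ 2) := fun v hv =>
    mul_pos (by positivity) (hDpos _ _ _ (cube_coord hv 2).1 (cube_coord hv 1).1)
  -- semialgebraicity
  have hFs : IsSemialgebraicFunOn ℚ (cube 3) F := by
    refine (isSemialgebraicFunOn_aeval_div_aeval isSemialgebraic_cube
      (2 * X 2 : MvPolynomial (Fin 3) ℚ)
      ((1 + X 0 * X 1) ^ 2 + X 2 ^ 2 * (1 - X 0 * X 1) ^ 2) ?_).congr ?_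
    · intro w hw
      have := (hD w hw).ne'
      simpa using this
    · intro w _
      simp [hF]
  have hHs : IsSemialgebraicFunOn ℚ (cube 3) H := by
    refine (isSemialgebraicFunOn_aeval_div_aeval isSemialgebraic_cube
      (2 * ((1 + X 0 * X 1) ^ 2 - X 2 ^ 2 * (1 - X 0 * X 1) ^ 2) : MvPolynomial (Fin 3) ℚ)
      (((1 + X 0 * X 1) ^ 2 + X 2 ^ 2 * (1 - X 0 * X 1) ^ 2) ^ 2) ?_).congr ?_
    · intro w hw
      have := (hD w hw).ne'
      simpa using this
    · intro w _
      simp [hH]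
  have hGs : IsSemialgebraicFunOn ℚ (cube 3) G := by
    refine (isSemialgebraicFunOn_aeval_div_aeval isSemialgebraic_cube
      (2 * X 2 * ((1 - X 0 ^ 2) + X 1 * X 2 * (1 + X 0 ^ 2)) : MvPolynomial (Fin 3) ℚ)
      ((1 + X 0 ^ 2) * ((1 + X 2 * X 1) ^ 2 + X 0 ^ 2 * (1 - X 2 * X 1) ^ 2)) ?_).congr ?_
    · intro v hv
      have := (hD' v hv).ne'
      simpa using this
    · intro v _
      simp [hG]
  -- continuity
  have hFc : ContinuousOn F (cube 3) :=
    ContinuousOn.div (by fun_prop) (by fun_prop) fun w hw => (hD w hw).ne'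
  have hHc : ContinuousOn H (cube 3) :=
    ContinuousOn.div (by fun_prop) (by fun_prop) fun w hw => pow_ne_zero 2 (hD w hw).ne'
  have hGc : ContinuousOn G (cube 3) :=
    ContinuousOn.div (by fun_prop) (by fun_prop) fun v hv => (hD' v hv).ne'
  -- the two fibrewise derivatives (closedness of the form)
  have hFd : ∀ z ∈ cube 2, ∀ t ∈ Ioo (0 : ℝ) 1,
      HasDerivAt (fun s : ℝ => F (Fin.snoc z s)) (H (Fin.snoc z t)) t := by
    intro z hz t _
    have hz0 := (cube_coord hz 0).1
    have hz1 := (cube_coord hz 1).1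
    have hc : 0 < (1 + z 0 * z 1) ^ 2 := by
      have : 0 < 1 + z 0 * z 1 := by nlinarith [mul_nonneg hz0 hz1]
      positivity
    have hden : (1 + z 0 * z 1) ^ 2 + t ^ 2 * (1 - z 0 * z 1) ^ 2 ≠ 0 := (hDpos _ _ t hz0 hz1).ne'
    have h1 : HasDerivAt (fun s : ℝ => 2 * s) 2 t := by
      simpa using (hasDerivAt_id' t).const_mul (2 : ℝ)
    have h2 : HasDerivAt (fun s : ℝ => (1 + z 0 * z 1) ^ 2 + s ^ 2 * (1 - z 0 * z 1) ^ 2)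
        (2 * t * (1 - z 0 * z 1) ^ 2) t := by
      simpa using ((hasDerivAt_pow 2 t).mul_const ((1 - z 0 * z 1) ^ 2)).const_add
        ((1 + z 0 * z 1) ^ 2)
    have h := h1.div h2 hden
    refine h.congr_deriv ?_
    change _ = 2 * ((1 + z 0 * z 1) ^ 2 - t ^ 2 * (1 - z 0 * z 1) ^ 2) /
      ((1 + z 0 * z 1) ^ 2 + t ^ 2 * (1 - z 0 * z 1) ^ 2) ^ 2
    ring
  have hGd : ∀ z ∈ cube 2, ∀ t ∈ Ioo (0 : ℝ) 1,
      HasDerivAt (fun s : ℝ => G (Fin.snoc z s))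
        (H (fun i => (Fin.snoc z t : Fin 3 → ℝ) (Equiv.swap (0 : Fin 3) 2 i))) t := by
    intro z hz t ht
    have hz0 := (cube_coord hz 0).1
    have hz1 := (cube_coord hz 1).1
    have hE : (0 : ℝ) < 1 + z 0 ^ 2 := by positivity
    have hC : 0 < (1 + t * z 1) ^ 2 + z 0 ^ 2 * (1 - t * z 1) ^ 2 := by
      have : 0 < 1 + t * z 1 := by nlinarith [mul_nonneg ht.1.le hz1]
      positivity
    have hM : (1 + z 0 ^ 2) * ((1 + t * z 1) ^ 2 + z 0 ^ 2 * (1 - t * z 1) ^ 2) ≠ 0 :=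
      (mul_pos hE hC).ne'
    have h := (((hasDerivAt_id' t).const_mul (2 : ℝ)).mul
      ((((hasDerivAt_id' t).const_mul (z 1)).mul_const (1 + z 0 ^ 2)).const_add (1 - z 0 ^ 2))).div
      ((((((hasDerivAt_id' t).mul_const (z 1)).const_add 1).pow 2).add
        (((((hasDerivAt_id' t).mul_const (z 1)).const_sub 1).pow 2).const_mul (z 0 ^ 2))).const_mul
        (1 + z 0 ^ 2)) hM
    refine h.congr_deriv ?_
    change _ = 2 * ((1 + t * z 1) ^ 2 - z 0 ^ 2 * (1 - t * z 1) ^ 2) /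
      ((1 + t * z 1) ^ 2 + z 0 ^ 2 * (1 - t * z 1) ^ 2) ^ 2
    simp only [Pi.mul_apply, Pi.add_apply, Pi.pow_apply, Nat.cast_ofNat,
      Nat.add_one_sub_one, pow_one, mul_one, one_mul]
    field_simp
    ring
  -- Green with rider
  obtain ⟨A₁, A₀, B₁, B₀, hA₁d, hA₁i, hA₀d, hA₀i, hB₁d, hB₁i, hB₀d, hB₀i, hrel⟩ :=
    green_rider (Equiv.swap (0 : Fin 3) 2) hFs hGs hHs hFc hGc hHc hFd hGd
  have hA₀ : of A₀ ∈ relations := of_mem_relations_of_eqOn_zero A₀ fun z _ => by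
    rw [hA₀i]
    change 2 * (0 : ℝ) / _ = 0
    simp
  have hB₀ : of B₀ ∈ relations := of_mem_relations_of_eqOn_zero B₀ fun z _ => by
    rw [hB₀i]
    change 2 * (0 : ℝ) * _ / _ = 0
    simp
  refine ⟨A₁, B₁, hA₁d, fun z hz => ?_, hB₁d, fun z hz => ?_, ?_⟩
  · rw [hA₁i]
    rw [← hA₁d] at hz
    have hz0 := (cube_coord (hA₁d ▸ hz) 0).1
    have hz1 := (cube_coord (hA₁d ▸ hz) 1).1
    change 2 * (1 : ℝ) / ((1 + z 0 * z 1) ^ 2 + 1 ^ 2 * (1 - z 0 * z 1) ^ 2) = 1 / (1 + (z 0 * z 1) ^ 2)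
    have h1 : (1 + z 0 * z 1) ^ 2 + 1 ^ 2 * (1 - z 0 * z 1) ^ 2 ≠ 0 := (hDpos _ _ 1 hz0 hz1).ne'
    have h2 : (1 + (z 0 * z 1) ^ 2) ≠ 0 := by positivity
    field_simp
    ring
  · rw [hB₁i]
    change 2 * (1 : ℝ) * ((1 - z 0 ^ 2) + z 1 * 1 * (1 + z 0 ^ 2)) /
      ((1 + z 0 ^ 2) * ((1 + 1 * z 1) ^ 2 + z 0 ^ 2 * (1 - 1 * z 1) ^ 2)) = _
    simp only [one_mul, mul_one]
  · have : of A₁ - of B₁ = (of A₁ - of A₀) - (of B₁ - of B₀) + of A₀ - of B₀ := by abel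
    rw [this]
    exact relations.sub_mem (relations.add_mem hrel hA₀) hB₀

/-- **Step two of the quarter-disc face.** There are representations `T`, `R`, `M` on the closed unit
square with integrands `2((1 − z₀²) + z₁(1 + z₀²))/((1 + z₀²)((1 + z₁)² + z₀²(1 − z₁)²))`,
`2/((1 + z₀²)(1 + z₁))` and `−2z₀²z₁/((1 + z₀²)(1 + z₀²z₁²))` with `[T] − [R] − [M] ∈ KZ.relations`:
Green's formula with rider `s = z₀` for the closed form `(2/(1+s²)) Re dw/(1+w)` in the coordinates
`w = r'ρ(sμ)` of the sector of the unit disc between `1` and `ρ(s)`.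
[cite: KontsevichZagier2001, §1.2 rule (3)] -/
theorem step_two : ∃ T R M : IntegralRep 2,
    T.domain = cube 2 ∧ EqOn T.integrand (fun z => 2 * ((1 - z 0 ^ 2) + z 1 * (1 + z 0 ^ 2)) /
      ((1 + z 0 ^ 2) * ((1 + z 1) ^ 2 + z 0 ^ 2 * (1 - z 1) ^ 2))) (cube 2) ∧
    R.domain = cube 2 ∧ EqOn R.integrand (fun z => 2 / ((1 + z 0 ^ 2) * (1 + z 1))) (cube 2) ∧
    M.domain = cube 2 ∧ EqOn M.integrand
      (fun z => -(2 * z 0 ^ 2 * z 1 / ((1 + z 0 ^ 2) * (1 + z 0 ^ 2 * z 1 ^ 2)))) (cube 2) ∧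
    of T - of R - of M ∈ relations := by
  -- the coefficient functions, coordinates `(s, r', μ)` for `F`, `H` and `(s, μ, r')` for `G`
  set F : (Fin 3 → ℝ) → ℝ := fun w =>
    2 * ((1 - (w 0 * w 2) ^ 2) + w 1 * (1 + (w 0 * w 2) ^ 2)) /
      ((1 + w 0 ^ 2) * ((1 + w 1) ^ 2 + (w 0 * w 2) ^ 2 * (1 - w 1) ^ 2)) with hF
  set H : (Fin 3 → ℝ) → ℝ := fun w =>
    -(8 * w 0 * (w 0 * w 2) * (1 - w 1 ^ 2)) /
      ((1 + w 0 ^ 2) * ((1 + w 1) ^ 2 + (w 0 * w 2) ^ 2 * (1 - w 1) ^ 2) ^ 2) with hH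
  set G : (Fin 3 → ℝ) → ℝ := fun v =>
    -(8 * v 0 * v 2 * (v 0 * v 1)) /
      ((1 + v 0 ^ 2) * (1 + (v 0 * v 1) ^ 2) * ((1 + v 2) ^ 2 + (v 0 * v 1) ^ 2 * (1 - v 2) ^ 2))
    with hG
  -- denominators
  have hEpos : ∀ a c : ℝ, 0 ≤ a → 0 < (1 + a) ^ 2 + c ^ 2 * (1 - a) ^ 2 := by
    intro a c ha
    have : 0 < 1 + a := by linarith
    positivity
  have hD : ∀ w ∈ cube 3,
      0 < (1 + w 0 ^ 2) * ((1 + w 1) ^ 2 + (w 0 * w 2) ^ 2 * (1 - w 1) ^ 2) := fun w hw =>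
    mul_pos (by positivity) (hEpos _ _ (hw 1).1)
  have hD' : ∀ v ∈ cube 3, 0 < (1 + v 0 ^ 2) * (1 + (v 0 * v 1) ^ 2) *
      ((1 + v 2) ^ 2 + (v 0 * v 1) ^ 2 * (1 - v 2) ^ 2) := fun v hv =>
    mul_pos (by positivity) (hEpos _ _ (hv 2).1)
  -- semialgebraicity
  have hFs : IsSemialgebraicFunOn ℚ (cube 3) F := by
    refine (isSemialgebraicFunOn_aeval_div_aeval isSemialgebraic_cube
      (2 * ((1 - (X 0 * X 2) ^ 2) + X 1 * (1 + (X 0 * X 2) ^ 2)) : MvPolynomial (Fin 3) ℚ)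
      ((1 + X 0 ^ 2) * ((1 + X 1) ^ 2 + (X 0 * X 2) ^ 2 * (1 - X 1) ^ 2)) ?_).congr ?_
    · intro w hw
      have := (hD w hw).ne'
      simpa using this
    · intro w _
      simp [hF]
  have hHs : IsSemialgebraicFunOn ℚ (cube 3) H := by
    refine (isSemialgebraicFunOn_aeval_div_aeval isSemialgebraic_cube
      (-(8 * X 0 * (X 0 * X 2) * (1 - X 1 ^ 2)) : MvPolynomial (Fin 3) ℚ)
      (((1 + X 0 ^ 2) * ((1 + X 1) ^ 2 + (X 0 * X 2) ^ 2 * (1 - X 1) ^ 2) ^ 2)) ?_).congr ?_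
    · intro w hw
      have h1 : (1 : ℝ) + w 0 ^ 2 ≠ 0 := by positivity
      have h2 := (hEpos _ (w 0 * w 2) (hw 1).1).ne'
      simp [h1, h2]
    · intro w _
      simp [hH]
  have hGs : IsSemialgebraicFunOn ℚ (cube 3) G := by
    refine (isSemialgebraicFunOn_aeval_div_aeval isSemialgebraic_cube
      (-(8 * X 0 * X 2 * (X 0 * X 1)) : MvPolynomial (Fin 3) ℚ)
      ((1 + X 0 ^ 2) * (1 + (X 0 * X 1) ^ 2) * ((1 + X 2) ^ 2 + (X 0 * X 1) ^ 2 * (1 - X 2) ^ 2))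
      ?_).congr ?_
    · intro v hv
      have := (hD' v hv).ne'
      simpa using this
    · intro v _
      simp [hG]
  -- continuity
  have hFc : ContinuousOn F (cube 3) :=
    ContinuousOn.div (by fun_prop) (by fun_prop) fun w hw => (hD w hw).ne'
  have hHc : ContinuousOn H (cube 3) := by
    refine ContinuousOn.div (by fun_prop) (by fun_prop) fun w hw => ?_
    exact mul_ne_zero (by positivity) (pow_ne_zero 2 (hEpos _ (w 0 * w 2) (hw 1).1).ne')
  have hGc : ContinuousOn G (cube 3) :=
    ContinuousOn.div (by fun_prop) (by fun_prop) fun v hv => (hD' v hv).ne'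
  -- the two fibrewise derivatives (closedness of the form)
  have hFd : ∀ z ∈ cube 2, ∀ t ∈ Ioo (0 : ℝ) 1,
      HasDerivAt (fun s : ℝ => F (Fin.snoc z s)) (H (Fin.snoc z t)) t := by
    intro z hz t _
    have hz1 := (hz 1).1
    have h0 : (0 : ℝ) < 1 + z 0 ^ 2 := by positivity
    have hE := hEpos _ (z 0 * t) hz1
    have hM : (1 + z 0 ^ 2) * ((1 + z 1) ^ 2 + (z 0 * t) ^ 2 * (1 - z 1) ^ 2) ≠ 0 :=
      (mul_pos h0 hE).ne'
    have hp : HasDerivAt (fun x : ℝ => (z 0 * x) ^ 2) (2 * (z 0 * t) * z 0) t := by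
      simpa [Pi.pow_def] using ((hasDerivAt_id' t).const_mul (z 0)).pow 2
    have h := (((hp.const_sub 1).add ((hp.const_add 1).const_mul (z 1))).const_mul 2).div
      (((hp.mul_const ((1 - z 1) ^ 2)).const_add ((1 + z 1) ^ 2)).const_mul (1 + z 0 ^ 2)) hM
    refine h.congr_deriv ?_
    change _ = -(8 * z 0 * (z 0 * t) * (1 - z 1 ^ 2)) /
      ((1 + z 0 ^ 2) * ((1 + z 1) ^ 2 + (z 0 * t) ^ 2 * (1 - z 1) ^ 2) ^ 2)
    have h0' := h0.ne'
    have hE' := hE.ne'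
    simp only [Pi.add_apply]
    field_simp
    ring
  have hGd : ∀ z ∈ cube 2, ∀ t ∈ Ioo (0 : ℝ) 1,
      HasDerivAt (fun s : ℝ => G (Fin.snoc z s))
        (H (fun i => (Fin.snoc z t : Fin 3 → ℝ) (Equiv.swap (1 : Fin 3) 2 i))) t := by
    intro z hz t ht
    have h0 : (0 : ℝ) < 1 + z 0 ^ 2 := by positivity
    have h1 : (0 : ℝ) < 1 + (z 0 * z 1) ^ 2 := by positivity
    have hE := hEpos t (z 0 * z 1) ht.1.le
    have hM : (1 + z 0 ^ 2) * (1 + (z 0 * z 1) ^ 2) *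
        ((1 + t) ^ 2 + (z 0 * z 1) ^ 2 * (1 - t) ^ 2) ≠ 0 := (mul_pos (mul_pos h0 h1) hE).ne'
    have h := (((hasDerivAt_id' t).const_mul (8 * z 0)).mul_const (z 0 * z 1)).neg.div
      (((((hasDerivAt_id' t).const_add 1).pow 2).add
        ((((hasDerivAt_id' t).const_sub 1).pow 2).const_mul ((z 0 * z 1) ^ 2))).const_mul
        ((1 + z 0 ^ 2) * (1 + (z 0 * z 1) ^ 2))) hM
    refine h.congr_deriv ?_
    change _ = -(8 * z 0 * (z 0 * z 1) * (1 - t ^ 2)) /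
      ((1 + z 0 ^ 2) * ((1 + t) ^ 2 + (z 0 * z 1) ^ 2 * (1 - t) ^ 2) ^ 2)
    have h0' := h0.ne'
    have h1' := h1.ne'
    have hE' := hE.ne'
    simp only [Pi.add_apply, Pi.pow_apply, Pi.neg_apply, Nat.cast_ofNat, Nat.add_one_sub_one,
      pow_one, mul_one]
    field_simp
    ring
  -- Green with rider
  obtain ⟨A₁, A₀, B₁, B₀, hA₁d, hA₁i, hA₀d, hA₀i, hB₁d, hB₁i, hB₀d, hB₀i, hrel⟩ :=
    green_rider (Equiv.swap (1 : Fin 3) 2) hFs hGs hHs hFc hGc hHc hFd hGd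
  have hB₀ : of B₀ ∈ relations := of_mem_relations_of_eqOn_zero B₀ fun z _ => by
    rw [hB₀i]
    change -(8 * z 0 * (0 : ℝ) * _) / _ = 0
    simp
  refine ⟨A₁, A₀, B₁, hA₁d, fun z _ => ?_, hA₀d, fun z hz => ?_, hB₁d, fun z hz => ?_, ?_⟩
  · rw [hA₁i]
    change 2 * ((1 - (z 0 * (1 : ℝ)) ^ 2) + z 1 * (1 + (z 0 * 1) ^ 2)) /
      ((1 + z 0 ^ 2) * ((1 + z 1) ^ 2 + (z 0 * 1) ^ 2 * (1 - z 1) ^ 2)) = _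
    simp only [mul_one]
  · rw [hA₀i]
    rw [← hA₀d] at hz
    have hz1 := ((hA₀d ▸ hz : z ∈ cube 2) 1).1
    change 2 * ((1 - (z 0 * (0 : ℝ)) ^ 2) + z 1 * (1 + (z 0 * 0) ^ 2)) /
      ((1 + z 0 ^ 2) * ((1 + z 1) ^ 2 + (z 0 * 0) ^ 2 * (1 - z 1) ^ 2)) = 2 / ((1 + z 0 ^ 2) * (1 + z 1))
    have h1 : (1 : ℝ) + z 1 ≠ 0 := by linarith
    have h2 : (1 : ℝ) + z 0 ^ 2 ≠ 0 := by positivity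
    field_simp
    ring
  · rw [hB₁i]
    change -(8 * z 0 * (1 : ℝ) * (z 0 * z 1)) /
      ((1 + z 0 ^ 2) * (1 + (z 0 * z 1) ^ 2) * ((1 + 1) ^ 2 + (z 0 * z 1) ^ 2 * (1 - 1) ^ 2)) =
      -(2 * z 0 ^ 2 * z 1 / ((1 + z 0 ^ 2) * (1 + z 0 ^ 2 * z 1 ^ 2)))
    have h1 : (1 : ℝ) + z 0 ^ 2 * z 1 ^ 2 ≠ 0 := by positivity
    have h2 : (1 : ℝ) + z 0 ^ 2 ≠ 0 := by positivity
    have h3 : (1 : ℝ) + (z 0 * z 1) ^ 2 ≠ 0 := by positivity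
    field_simp
    ring
  · have : of A₁ - of A₀ - of B₁ = (of A₁ - of A₀) - (of B₁ - of B₀) - of B₀ := by abel
    rw [this]
    exact relations.sub_mem hrel hB₀

end Summit.KontsevichZagierPeriods.OctahedralSymmetry.QuarterDiscFace

end
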